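import Summits.Ventures.CertifiedArithmetic.Expansions.CompressValuationSteps
import Summits.Ventures.CertifiedArithmetic.Expansions.CompressValuationSlack
import Mathlib.Tactic.Linarith
import Mathlib.Tactic.Positivity
import Mathlib.Tactic.Ring
import Mathlib.Tactic.NormNum

/-!
# COMPRESS, termination: both sweeps lower the potential (new work)

New work of the certified-arithmetic venture (ENGINES group: shared numerical engines serving
client cells; rigour lives in the verifiers; every published number belongs to a client cell's
ledger, not to the engines group).  The two sweeps of ONE pass of COMPRESS [Shewchuk1997, §2.7,
Fig. 11; Thm 23] in 2-adic valuations, for any round-to-nearest whose roundoffs lie 2-below the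
rounded sums (e.g. ties-to-even) and `p ≥ 2`:

* the DOWNWARD SWEEP `compressDown_valPot` (Lines 1–9, from a nonzero carry over nonzero
  NONADJACENT components): every step is a nonadjacent pair (`fastTwoSum_valuation_down`), so the
  potential `valPot` drops unless the sweep changes nothing, no output component vanishes, and the
  output carries the half-ulp slack `DownSlack`;
* the UPWARD SWEEP `compressUp_valPot` (Lines 10–16) run on that output — with the tree's
  invariants of `compressUp_spec` (`UpInv` with gap 2, the stair, the chain, `|Q| ≤ ulp(g)`) plus
  a NONZERO carry and the slack `UpSlack`: at a component `g` with a full odd significand the slack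
  and the gap-2 bound `|emitted| < 2^(v Q − 1)` give `|Q| < ulp(g)/2`, so FAST-TWO-SUM(g, Q) =
  (g, Q) (`fastTwoSum_eq_of_fullOdd`); at a component with a trailing zero
  `fastTwoSum_valuation_up` applies; either way the next carry is at most as divisible as `g`,
  which keeps the slack alive, and the potential drops unless nothing changes.

`CompressTerminates.lean` combines the two into `valPot_compress_lt` and iterates.  (The module
docstrings of `DyadicValuation.lean` and `CompressValuationSteps.lean` announce this material under
the working names `CompressValuationDown.lean` / `CompressValuationUp.lean`; it was regrouped into
`CompressValuationSlack.lean` and the present file.)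

References: J. R. Shewchuk, Discrete Comput. Geom. 18 (1997) 305–363, §2.7 and Thm 23
[Shewchuk1997]; S. Boldo, C.-P. Jeannerod, G. Melquiond, J.-M. Muller, Acta Numerica 32 (2023),
§2.1 [BoldoEtAl2023].
-/

namespace Summit.Ventures.CertifiedArithmetic.Expansions

open Literature.ComputerArithmetic.JeannerodRump2018
open Literature.ComputerArithmetic.BoldoJeannerodMelquiondMuller2023 hiding twoSum twoSum_fst
open Literature.ComputerArithmetic.Shewchuk1997

variable {p : ℕ} {emin : ℤ} {fl : ℚ → ℚ}

/-! ### Lines 1–9: the downward sweep in valuations -/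

/-- What the valuation analysis adds to the tree's `DownOut` for the downward sweep from the
carry `Q` over `xs` (largest first) with output `gs` (largest first) and `gb`. -/
structure DownVal (p : ℕ) (emin : ℤ) (Q : ℚ) (xs gs : List ℚ) (gb : ℚ) : Prop where
  /-- The sweep is exact. -/
  sum_eq : gs.sum + gb = Q + xs.sum
  /-- No output component vanishes. -/
  ne : ∀ g ∈ gs ++ [gb], g ≠ 0
  /-- The top output component is at most as divisible as the carry it came from. -/
  headv : ∀ g ∈ (gs ++ [gb]).head?, padicValRat 2 g ≤ padicValRat 2 Q
  /-- The half-ulp slack below the full-odd output components. -/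
  slack : DownSlack p emin (gs ++ [gb])
  /-- The potential drops — unless nothing happened at all. -/
  pot : valPot emin (gs ++ [gb]) < valPot emin (Q :: xs) ∨ gs ++ [gb] = Q :: xs

/-- **THE DOWNWARD SWEEP LOWERS THE POTENTIAL** (Lines 1–9 of COMPRESS; any round-to-nearest
whose roundoffs lie 2-below the rounded sums, `p ≥ 2`): from a nonzero float carry `Q` over
nonzero floats `xs` (largest first), pairwise nonadjacent and with the top one nonadjacent below
`Q`, the sweep is exact, emits no zero, its top component is at most as divisible as `Q`, the
output has the half-ulp slack, and its potential is strictly smaller than that of `Q :: xs`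
unless the output IS `Q :: xs`. [cite: Shewchuk1997, §2.7 p. 332 (COMPRESS), Thm 23 p. 333] -/
theorem compressDown_valPot (hp : 2 ≤ p) (hfl : IsRoundNearest p emin fl)
    (hfl2 : RoundoffBelow 2 fl) :
    ∀ (xs : List ℚ) (Q : ℚ), IsFloat p emin Q → Q ≠ 0 → (∀ y ∈ xs, IsFloat p emin y) →
      (∀ y ∈ xs, y ≠ 0) → xs.Pairwise (fun a b => Below 2 b a) →
      (∀ y ∈ xs.head?, Below 2 y Q) →
      DownVal p emin Q xs (compressDown fl Q xs).1 (compressDown fl Q xs).2 := by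
  have hp1 : 1 ≤ p := le_trans (by norm_num) hp
  have two0 : (2 : ℚ) ≠ 0 := by norm_num
  intro xs
  induction xs with
  | nil =>
    intro Q _ hQ0 _ _ _ _
    rw [compressDown_nil]
    refine ⟨by simp, by simpa using hQ0, by simp, ?_, Or.inr (by simp)⟩
    simp only [List.nil_append, downSlack_cons]
    exact ⟨by simp, trivial⟩
  | cons x xs ih =>
    intro Q hQ hQ0 hF hne hpw hbel
    have hx : IsFloat p emin x := hF x (by simp)
    have hx0 : x ≠ 0 := hne x (by simp)
    have hxsF : ∀ y ∈ xs, IsFloat p emin y := fun y hy => hF y (List.mem_cons_of_mem _ hy)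
    have hxsne : ∀ y ∈ xs, y ≠ 0 := fun y hy => hne y (List.mem_cons_of_mem _ hy)
    obtain ⟨hbelx, hpw'⟩ := List.pairwise_cons.mp hpw
    have hxQ : Below 2 x Q := hbel x (by simp)
    have hxQ' : |x| ≤ |Q| := (hxQ.abs_lt (by norm_num) hQ0).le
    have hvQ := emin_le_padicValRat_two hQ hQ0
    have hvx := emin_le_padicValRat_two hx hx0
    obtain ⟨hv2, hx1ne, hsum, hmerge, hact⟩ :=
      fastTwoSum_valuation_down hp hfl hx hQ hx0 hQ0 hxQ
    obtain ⟨h1, -, h2, -⟩ := fastTwoSum_exact hp1 hfl hQ hx hxQ'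
    have hF12 := isFloat_fastTwoSum hfl Q x
    by_cases hq : (fastTwoSum fl Q x).2 = 0
    · -- MERGE: the carry becomes `Q + x`, of valuation `v x`
      rw [compressDown_cons_of_eq_zero hq]
      have hvQn := hmerge hq
      generalize hQn : (fastTwoSum fl Q x).1 = Qn at *
      have hQnval : Qn = Q + x := by rw [hq, add_zero] at hsum; exact hsum
      have hbelQn : ∀ y ∈ xs.head?, Below 2 y Qn := fun y hy =>
        below_of_padicValRat_le (hbelx y (List.mem_of_mem_head? hy)) hx0
          (OnGrid.of_isFloat hF12.1) hx1ne hvQn.ge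
      have out := ih Qn hF12.1 hx1ne hxsF hxsne hpw' hbelQn
      refine ⟨by rw [out.sum_eq, hQnval, List.sum_cons, add_assoc], out.ne,
        fun g hg => (out.headv g hg).trans (by omega), out.slack, Or.inl ?_⟩
      have hle : valPot emin ((compressDown fl Qn xs).1 ++ [(compressDown fl Qn xs).2]) ≤
          valPot emin (Qn :: xs) := by
        rcases out.pot with h | h
        · exact h.le
        · rw [h]
      rw [valPot_cons, hvQn] at hle
      rw [valPot_cons, valPot_cons]
      omega
    · -- EMIT `Qn`, continue with the roundoff `q`, of valuation `v x`
      rw [compressDown_cons_of_ne_zero hq]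
      dsimp only
      obtain ⟨hvq, hvQn_lt⟩ := hact hq
      generalize hQn : (fastTwoSum fl Q x).1 = Qn at *
      generalize hqn : (fastTwoSum fl Q x).2 = q at *
      have hbelq : ∀ y ∈ xs.head?, Below 2 y q := fun y hy =>
        below_of_padicValRat_le (hbelx y (List.mem_of_mem_head? hy)) hx0
          (OnGrid.of_isFloat hF12.2) hq hvq.ge
      have out := ih q hF12.2 hq hxsF hxsne hpw' hbelq
      have hvQnle : padicValRat 2 Qn ≤ padicValRat 2 Q := by
        by_cases h : Qn = Q
        · rw [h]
        · exact (hvQn_lt h).le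
      refine ⟨?_, ?_, ?_, ?_, ?_⟩
      · simp only [List.sum_cons]; linarith [out.sum_eq]
      · rw [List.cons_append]; exact List.forall_mem_cons.mpr ⟨hx1ne, out.ne⟩
      · intro g hg
        have : Qn = g := by simpa using hg
        subst this
        exact hvQnle
      · -- the half-ulp slack below `Qn`, when `Qn` is full-odd
        rw [List.cons_append, downSlack_cons]
        refine ⟨fun a ha k hk hodd => ?_, out.slack⟩
        have hva : padicValRat 2 a ≤ padicValRat 2 q := out.headv a ha
        -- the roundoff lies 2-below the FULL-ODD `Qn`: `|q| < 2^k / 2`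
        have hbelow : Below 2 q Qn := by rw [h2, h1]; exact hfl2 (Q + x)
        obtain ⟨s, hsQn, hqs⟩ := hbelow
        have hsk : s ≤ k := by
          by_contra hlt
          exact hodd (hsQn.mono (by omega))
        have h2s : (2 : ℚ) ^ s ≤ (2 : ℚ) ^ k := zpow_le_zpow_right₀ (by norm_num) hsk
        have ek : (2 : ℚ) ^ k = 2 ^ (k - 1) * 2 := by
          rw [← zpow_add_one₀ two0, sub_add_cancel]
        have hqlt : |q| < (2 : ℚ) ^ (k - 1) := by linarith
        have hgq : OnGrid (padicValRat 2 q) q :=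
          onGrid_padicValRat_two (OnGrid.of_isFloat hF12.2) hq
        have hαk : padicValRat 2 q ≤ k - 1 :=
          (padicValRat_two_lt_of_abs_lt hgq hq hqlt).le
        have hqle : |q| ≤ (2 : ℚ) ^ (k - 1) - (2 : ℚ) ^ (padicValRat 2 q) :=
          abs_le_two_zpow_sub_of_onGrid hgq hαk hqlt
        -- everything below `x` is nonadjacent below `q` (same valuation): sum `< 2^(v q - 1)`
        have hbelq' : ∀ y ∈ xs, Below 2 y q := fun y hy =>
          below_of_padicValRat_le (hbelx y hy) hx0 (OnGrid.of_isFloat hF12.2) hq hvq.ge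
        have hxs : |xs.sum| < (2 : ℚ) ^ (padicValRat 2 q - 1) :=
          abs_sum_lt_two_zpow_padicValRat_sub_one hq hxsF hpw' hbelq'
        have eα : (2 : ℚ) ^ (padicValRat 2 q) = 2 ^ (padicValRat 2 q - 1) * 2 := by
          rw [← zpow_add_one₀ two0, sub_add_cancel]
        have hαa : (2 : ℚ) ^ (padicValRat 2 a - 1) ≤ (2 : ℚ) ^ (padicValRat 2 q - 1) :=
          zpow_le_zpow_right₀ (by norm_num) (by omega)
        have hs' : ((compressDown fl q xs).1 ++ [(compressDown fl q xs).2]).sum = q + xs.sum := by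
          rw [List.sum_append, List.sum_singleton, out.sum_eq]
        rw [hs']
        calc |q + xs.sum| ≤ |q| + |xs.sum| := abs_add_le _ _
          _ < (2 : ℚ) ^ (k - 1) - (2 : ℚ) ^ (padicValRat 2 q) + 2 ^ (padicValRat 2 q - 1) := by
            linarith
          _ ≤ (2 : ℚ) ^ k / 2 - (2 : ℚ) ^ (padicValRat 2 a - 1) := by linarith
      · -- the potential
        have hle : valPot emin ((compressDown fl q xs).1 ++ [(compressDown fl q xs).2]) ≤
            valPot emin (q :: xs) := by
          rcases out.pot with h | h
          · exact h.le
          · rw [h]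
        by_cases hQnQ : Qn = Q
        · have hqx : q = x := by rw [hQnQ] at hsum; linarith
          rcases out.pot with h | h
          · left
            rw [valPot_cons, hvq] at h
            rw [List.cons_append, valPot_cons, valPot_cons, valPot_cons, hQnQ]
            omega
          · right
            rw [List.cons_append, h, hQnQ, hqx]
        · left
          have hlt := hvQn_lt hQnQ
          rw [valPot_cons, hvq] at hle
          rw [List.cons_append, valPot_cons, valPot_cons, valPot_cons]
          omega

/-! ### Lines 10–16: the upward sweep in valuations -/

/-- **THE UPWARD SWEEP LOWERS THE POTENTIAL** (Lines 10–16 of COMPRESS; any round-to-nearest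
whose roundoffs lie 2-below the rounded sums, `p ≥ 2`): from a state `(rs, Q)` of the sweep
satisfying the tree's `UpInv` with gap 2 and `Q ≠ 0`, over remaining components `gs` (smallest
first) that are floats `≥ 2^(emin+p)` obeying the stair and the chain, with `|Q| ≤ ulp` of the
next one and the half-ulp slack at level `v Q`, the output `compressUp fl Q gs` has potential
strictly below that of `Q :: gs` — unless it IS `Q :: gs`.
[cite: Shewchuk1997, §2.7 p. 332 (COMPRESS), Thm 23 p. 333 (proof)] -/
theorem compressUp_valPot (hp : 2 ≤ p) (hfl : IsRoundNearest p emin fl)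
    (hfl2 : RoundoffBelow 2 fl) :
    ∀ (gs : List ℚ) (Q : ℚ) (rs : List ℚ), UpInv p emin 2 rs Q → Q ≠ 0 →
      (∀ g ∈ gs, IsFloat p emin g) → (∀ g ∈ gs, (2 : ℚ) ^ (emin + p) ≤ |g|) →
      UStair p emin (Q + rs.sum) gs → gs.IsChain (fun a b => |a| ≤ ulp p emin b) →
      (∀ g ∈ gs.head?, |Q| ≤ ulp p emin g) →
      UpSlack p emin (padicValRat 2 Q) (Q + rs.sum) gs →
      valPot emin (compressUp fl Q gs) < valPot emin (Q :: gs) ∨ compressUp fl Q gs = Q :: gs := by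
  have hp1 : 1 ≤ p := le_trans (by norm_num) hp
  have hc : (1 : ℚ) ≤ 2 := by norm_num
  intro gs
  induction gs with
  | nil =>
    intro Q rs _ _ _ _ _ _ _ _
    exact Or.inr (by simp)
  | cons g rest ih =>
    intro Q rs inv hQ0 hF hbig hst hch hQg hslack
    have hg : IsFloat p emin g := hF g (by simp)
    have hgbig : (2 : ℚ) ^ (emin + p) ≤ |g| := hbig g (by simp)
    have hQg' : |Q| ≤ ulp p emin g := hQg g (by simp)
    have hF' : ∀ x ∈ rest, IsFloat p emin x := fun x hx => hF x (List.mem_cons_of_mem _ hx)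
    have hbig' : ∀ x ∈ rest, (2 : ℚ) ^ (emin + p) ≤ |x| :=
      fun x hx => hbig x (List.mem_cons_of_mem _ hx)
    obtain ⟨-, hst'⟩ := uStair_cons.mp hst
    obtain ⟨hgU, hch'⟩ := List.isChain_cons.mp hch
    obtain ⟨hslackg, hslack'⟩ := upSlack_cons.mp hslack
    have hg0 : g ≠ 0 := by
      intro h; rw [h, abs_zero] at hgbig
      exact absurd hgbig (not_le.mpr (zpow_pos (by norm_num) _))
    have hulpg : ulp p emin g ≤ |g| := ulp_le_abs_of_isFloat hg hg0
    have hQleg : |Q| ≤ |g| := hQg'.trans hulpg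
    have hvQ := emin_le_padicValRat_two inv.hQ hQ0
    obtain ⟨h1, -, -, h4⟩ := fastTwoSum_exact hp1 hfl hg inv.hQ hQleg
    obtain ⟨k, hek, hk⟩ := exists_ulp_eq_two_zpow (p := p) (emin := emin) g
    by_cases hodd : OnGrid (k + 1) g
    · -- `g` HAS A TRAILING ZERO: the up-step lemma
      obtain ⟨hvQk, hkvg, hx0, hsum, -, hmerge, hact⟩ :=
        fastTwoSum_valuation_up hp hfl hg inv.hQ hg0 hQ0 hk hodd hQg'
      by_cases hq : (fastTwoSum fl g Q).2 = 0
      · -- exact step: the carry becomes `g + Q`, of valuation `v Q`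
        obtain ⟨inv', hQnval, hQn_ge⟩ := inv.absorb hp hfl hg hgbig hQg' hq
        rw [compressUp_cons_of_eq_zero hq]
        have hvQn := hmerge hq
        generalize hQn : (fastTwoSum fl g Q).1 = Qn at *
        have hS : Qn + rs.sum = Q + rs.sum + g := by rw [hQnval]; ring
        have hQg_next : ∀ y ∈ rest.head?, |Qn| ≤ ulp p emin y := by
          intro y hy
          have hgy : |g| ≤ ulp p emin y := hgU y hy
          have hT : |Qn + rs.sum| < ulp p emin y := by rw [hS]; exact hst'.head_lt hy
          obtain ⟨u, -, hU⟩ := exists_ulp_eq_two_zpow (p := p) (emin := emin) y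
          obtain ⟨k', -, hK⟩ := exists_ulp_eq_two_zpow (p := p) (emin := emin) Q
          have hkQ : OnGrid k' Q := by
            obtain ⟨K, hK'⟩ := exists_eq_int_mul_ulp_of_isFloat (p := p) (emin := emin) inv.hQ
            exact ⟨K, by rw [← hK]; exact hK'⟩
          have hkg : OnGrid k' g :=
            onGrid_of_two_zpow_le_ulp hg (by rw [← hK]; exact ulp_mono hQleg)
          have hkQn : OnGrid k' Qn := by rw [hQnval]; exact hkg.add hkQ
          have hku : k' ≤ u := by
            have : (2 : ℚ) ^ k' ≤ (2 : ℚ) ^ u := by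
              rw [← hK, ← hU]; exact (ulp_mono hQleg).trans (hulpg.trans hgy)
            exact (zpow_le_zpow_iff_right₀ (by norm_num : (1 : ℚ) < 2)).mp this
          have hr : |rs.sum| < (2 : ℚ) ^ k' := by rw [← hK]; exact inv.sum_lt
          rw [hU]
          exact abs_le_two_zpow_of_onGrid hku hkQn hr (by rw [← hU]; exact hT)
        have hslack_next : UpSlack p emin (padicValRat 2 Qn) (Qn + rs.sum) rest := by
          rw [hS, hvQn]; exact hslack'.mono (by omega)
        have out := ih Qn rs inv' hx0 hF' hbig' (by rw [hS]; exact hst') hch' hQg_next hslack_next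
        left
        have hle : valPot emin (compressUp fl Qn rest) ≤ valPot emin (Qn :: rest) := by
          rcases out with h | h
          · exact h.le
          · rw [h]
        rw [valPot_cons, hvQn] at hle
        rw [valPot_cons, valPot_cons]
        omega
      · -- inexact step: `q` is emitted, the carry becomes `Qn`
        obtain ⟨inv', hbound⟩ := inv.emit hp hfl hc hfl2 hg hgbig hQg' hq
        rw [compressUp_cons_of_ne_zero hq]
        have hact' := hact hq
        generalize hQn : (fastTwoSum fl g Q).1 = Qn at *
        generalize hqn : (fastTwoSum fl g Q).2 = q at *
        have hS : Qn + (q :: rs).sum = Q + rs.sum + g := by rw [List.sum_cons]; linarith [hsum]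
        have hQg_next : ∀ y ∈ rest.head?, |Qn| ≤ ulp p emin y := by
          intro y hy
          have hgy : |g| ≤ ulp p emin y := hgU y hy
          have hT : |Qn + (q :: rs).sum| < ulp p emin y := by rw [hS]; exact hst'.head_lt hy
          obtain ⟨u, hu, hU⟩ := exists_ulp_eq_two_zpow (p := p) (emin := emin) y
          obtain ⟨k', -, hK⟩ := exists_ulp_eq_two_zpow (p := p) (emin := emin) (g + Q)
          have hkQn : OnGrid k' Qn := by
            obtain ⟨K, hK'⟩ := exists_fl_eq_int_mul_ulp hp1 hfl (g + Q)
            exact ⟨K, by rw [h1, hK', hK]⟩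
          have hku : k' ≤ u := by
            have ht2 : |g + Q| ≤ 2 * (2 : ℚ) ^ u :=
              calc |g + Q| ≤ |g| + |Q| := abs_add_le _ _
                _ ≤ |g| + |g| := by linarith
                _ ≤ 2 * (2 : ℚ) ^ u := by rw [← hU]; linarith
            have := ulp_le_two_zpow_of_abs_le hp hu ht2
            rw [hK] at this
            exact (zpow_le_zpow_iff_right₀ (by norm_num : (1 : ℚ) < 2)).mp this
          have hr : |(q :: rs).sum| < (2 : ℚ) ^ k' := by rw [← hK, List.sum_cons]; exact hbound
          rw [hU]
          exact abs_le_two_zpow_of_onGrid hku hkQn hr (by rw [← hU]; exact hT)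
        have hvQn_le : padicValRat 2 Qn ≤ padicValRat 2 g := by
          by_cases h : Qn = g
          · rw [h]
          · exact (hact' h).1.trans (by omega)
        have hslack_next : UpSlack p emin (padicValRat 2 Qn) (Qn + (q :: rs).sum) rest := by
          rw [hS]; exact hslack'.mono hvQn_le
        have out := ih Qn (q :: rs) inv' hx0 hF' hbig' (by rw [hS]; exact hst') hch' hQg_next
          hslack_next
        by_cases hQng : Qn = g
        · have hqQ : q = Q := by rw [hQng] at hsum; linarith
          rcases out with h | h
          · left
            have hvv : padicValRat 2 Qn = padicValRat 2 g := by rw [hQng]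
            rw [valPot_cons, hvv] at h
            rw [valPot_cons, valPot_cons, valPot_cons, hqQ]
            omega
          · right
            rw [h, hqQ, hQng]
        · left
          obtain ⟨hvQnk, hvqQ⟩ := hact' hQng
          have hle : valPot emin (compressUp fl Qn rest) ≤ valPot emin (Qn :: rest) := by
            rcases out with h | h
            · exact h.le
            · rw [h]
          rw [valPot_cons] at hle
          rw [valPot_cons, valPot_cons, valPot_cons]
          omega
    · -- `g` IS FULL-ODD: the slack forces `|Q| < ulp(g)/2`, the step is inert
      have hS_lt := hslackg k hk hodd
      have hrs : |rs.sum| < (2 : ℚ) ^ (padicValRat 2 Q - 1) :=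
        abs_sum_lt_two_zpow_padicValRat_sub_one hQ0 inv.floats inv.pw (inv.below_of_mem hc)
      have hQlt : |Q| < (2 : ℚ) ^ k / 2 := by
        have h := abs_add_le (Q + rs.sum) (-rs.sum)
        rw [abs_neg, add_neg_cancel_right] at h
        linarith
      have hF2S : fastTwoSum fl g Q = (g, Q) :=
        fastTwoSum_eq_of_fullOdd hp hfl hg hg0 inv.hQ hk hodd hQlt
      have hq : (fastTwoSum fl g Q).2 ≠ 0 := by rw [hF2S]; exact hQ0
      obtain ⟨inv', -⟩ := inv.emit hp hfl hc hfl2 hg hgbig hQg' hq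
      rw [compressUp_cons_of_ne_zero hq]
      rw [hF2S] at inv' ⊢
      dsimp only at inv' ⊢
      have hS : g + (Q :: rs).sum = Q + rs.sum + g := by rw [List.sum_cons]; ring
      have hslack_next : UpSlack p emin (padicValRat 2 g) (g + (Q :: rs).sum) rest := by
        rw [hS]; exact hslack'
      have out := ih g (Q :: rs) inv' hg0 hF' hbig' (by rw [hS]; exact hst') hch' hgU hslack_next
      rcases out with h | h
      · left
        rw [valPot_cons] at h
        rw [valPot_cons, valPot_cons, valPot_cons]
        omega
      · right
        rw [h]

end Summit.Ventures.CertifiedArithmetic.Expansions
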